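import Summits.Ventures.Crystal3D.Kissing125.GSearchTransport
import Summits.Ventures.Crystal3D.Kissing125.GSearchDefs1
import HarnessLib

/-!
# Soundness of the numeric kernel of the growth search, κ-generic

HONEST FRAMING (cell pub-crystal3d, K-path at `h = 5/4`, V4 = κ as an explicit parameter): this is NOT a result printed
by Hales; it is his METHOD (arXiv:1209.6043, Theorem 3 + Lemmas 7–10, in the tree's form of a verified interval-arithmetic
growth search, `Literature/…/KissingSearch*.lean`) with the largest long-side cosine `κ` made an EXPLICIT PARAMETER
(`κ : Kappa`, carrying the two numeric facts the soundness proof uses: `-1/2 ≤ κ`, `κ < 1/4`).  Only the declarations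
whose statement depends on `κ` are declared here (namespace `…Kissing125.GSearch`, the tree's short names, no renames);
every κ-free helper is the landed K25 copy (`…Kissing125.KissingSearch.*`) and every κ-free lemma is cited from the tree
(PRIVATE per-file citation aliases; `GSearchTransport.lean` holds `toT : St → tree St` and the transport equalities).  The K25
instance is `κ25 = ⟨7/32, …⟩`; `GSearchBridge.lean` identifies the generic checker at
`κ25` with the landed `Kissing125.KissingSearch.checkPart`, so the landed run files are consumed unchanged.  Generated by
`HOME/lean/kissing125/v4-prep/gen/mkgen.py`; nothing here is asserted about GAP(1.26) or any census.

THIS FILE: the κ-tainted declarations of `Literature/Geometry/DiscreteGeometry/KissingSearchNumerics.lean` (part 1 of 1), with `κ : Kappa` threaded; κ-free declarations of that file are NOT re-declared publicly (the κ-free helpers are the landed K25 copies; the κ-free tree lemmas used by the proofs are cited through PRIVATE aliases at the top of the file).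

## References
* T. C. Hales, *A proof of Fejes Tóth's conjecture on sphere packings with kissing number twelve*,
  arXiv:1209.6043 (2012): Definition 1, Theorem 2, Theorem 3, Lemmas 7–10. [`Hales2012`]
* R. E. Moore, *Interval Analysis* (1966), Theorem 3.1, §4.4. [`Moore1966`]
-/

namespace Summit.Ventures.Crystal3D.Kissing125

open Literature.Geometry.DiscreteGeometry
open Summit.Ventures.Crystal3D.Kissing125.KissingSearch

namespace GSearch

open Real Literature.Analysis.ValidatedNumerics KissingLP NonemptyInterval Finset

variable {κ : Kappa}

/-! ### κ-free tree lemmas used below, read over the K25 copies (PRIVATE citation aliases; the public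
surface of this file is κ-generic only) -/

/-- K25 reading of the tree lemma `NS_eq` (κ-free; proof = citation of the tree lemma). [folklore] -/
private theorem NS_eq : NS = 16 :=
  Literature.Geometry.DiscreteGeometry.KissingSearch.NS_eq

/-- K25 reading of the tree lemma `arccos_le_ladUp_mul` (κ-free; proof = citation of the tree lemma). [folklore] -/
private theorem arccos_le_ladUp_mul (q : ℚ) :
  arccos (↑q : ℝ) ≤ (↑(ladUp q) : ℝ) * (↑δ : ℝ) :=
  Literature.Geometry.DiscreteGeometry.KissingSearch.arccos_le_ladUp_mul q

/-- K25 reading of the tree lemma `brHi_mkBr` (κ-free; proof = citation of the tree lemma). [folklore] -/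
private theorem brHi_mkBr (lo hi : ℕ) (h : hi < 16384) : brHi (mkBr lo hi) = hi :=
  Literature.Geometry.DiscreteGeometry.KissingSearch.brHi_mkBr lo hi h

/-- K25 reading of the tree lemma `brLo_mkBr` (κ-free; proof = citation of the tree lemma). [folklore] -/
private theorem brLo_mkBr (lo hi : ℕ) (h : hi < 16384) : brLo (mkBr lo hi) = lo :=
  Literature.Geometry.DiscreteGeometry.KissingSearch.brLo_mkBr lo hi h

/-- K25 reading of the tree lemma `encl_foldl_of_acc` (κ-free; proof = citation of the tree lemma). [folklore] -/
private theorem encl_foldl_of_acc {L : List ℕ} {g : ℕ → ℕ} {acc : ℕ} {θ : ℝ}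
  (h : Encl acc θ) : Encl (List.foldl (fun acc c ↦ brHull acc (g c)) acc L) θ :=
  Literature.Geometry.DiscreteGeometry.KissingSearch.encl_foldl_of_acc h

/-- K25 reading of the tree lemma `encl_foldl_of_mem` (κ-free; proof = citation of the tree lemma). [folklore] -/
private theorem encl_foldl_of_mem {L : List ℕ} {g : ℕ → ℕ} (acc : ℕ) {θ : ℝ} {σ : ℕ}
  (hσ : σ ∈ L) (h : Encl (g σ) θ) : Encl (List.foldl (fun acc c ↦ brHull acc (g c)) acc L) θ :=
  Literature.Geometry.DiscreteGeometry.KissingSearch.encl_foldl_of_mem acc hσ h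

/-- K25 reading of the tree lemma `encl_foldl_of_step` (κ-free; proof = citation of the tree lemma). [folklore] -/
private theorem encl_foldl_of_step {F : ℕ → ℕ → ℕ} {θ : ℝ} {σ : ℕ}
  (mono : ∀ (acc a : ℕ), Encl acc θ → Encl (F acc a) θ) (step : ∀ (acc : ℕ), Encl (F acc σ) θ) (L : List ℕ) (acc : ℕ) :
  σ ∈ L → Encl (List.foldl F acc L) θ :=
  Literature.Geometry.DiscreteGeometry.KissingSearch.encl_foldl_of_step mono step L acc

/-- K25 reading of the tree lemma `eval_pExpr` (κ-free; proof = citation of the tree lemma). [folklore] -/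
private theorem eval_pExpr (x y z : ℝ) : RExpr.eval (pt3 x y z) pExpr = Pfun x y z :=
  Literature.Geometry.DiscreteGeometry.KissingSearch.eval_pExpr x y z

/-- K25 reading of the tree lemma `eval_qExpr` (κ-free; proof = citation of the tree lemma). [folklore] -/
private theorem eval_qExpr (x y z : ℝ) :
  RExpr.eval (pt3 x y z) qExpr = (z - x * y) * (√(1 - x ^ 2) * √(1 - y ^ 2))⁻¹ :=
  Literature.Geometry.DiscreteGeometry.KissingSearch.eval_qExpr x y z

/-- K25 reading of the tree lemma `foldSyms_eq_foldl` (κ-free; proof = citation of the tree lemma). [folklore] -/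
private theorem foldSyms_eq_foldl {β : Type} (f : β → ℕ → β) (r : ℕ) (acc : β) :
  foldSyms f r acc = List.foldl f acc (symsList r) :=
  by rw [foldSyms_tr]; exact Literature.Geometry.DiscreteGeometry.KissingSearch.foldSyms_eq_foldl f r acc

/-- K25 reading of the tree lemma `foldl_minBr_le_of_mem` (κ-free; proof = citation of the tree lemma). [folklore] -/
private theorem foldl_minBr_le_of_mem {L : List ℕ} {br : ℕ} (hbr : br ∈ L)
  (hne : br ≠ NOBR) (m : ℕ) : List.foldl (fun m br ↦ if br = NOBR then m else min m (brLo br)) m L ≤ brLo br :=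
  Literature.Geometry.DiscreteGeometry.KissingSearch.foldl_minBr_le_of_mem hbr hne m

/-- K25 reading of the tree lemma `ladDown_mul_le_arccos` (κ-free; proof = citation of the tree lemma). [folklore] -/
private theorem ladDown_mul_le_arccos (q : ℚ) :
  (↑(ladDown q) : ℝ) * (↑δ : ℝ) ≤ arccos (↑q : ℝ) :=
  Literature.Geometry.DiscreteGeometry.KissingSearch.ladDown_mul_le_arccos q

/-- K25 reading of the tree lemma `ladUp_le` (κ-free; proof = citation of the tree lemma). [folklore] -/
private theorem ladUp_le (q : ℚ) : ladUp q ≤ NLAD :=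
  Literature.Geometry.DiscreteGeometry.KissingSearch.ladUp_le q

/-- K25 reading of the tree lemma `lt_NS_of_mem_symsList` (κ-free; proof = citation of the tree lemma). [folklore] -/
private theorem lt_NS_of_mem_symsList {r σ : ℕ} (hr : ValidDom r)
  (hσ : σ ∈ symsList r) : σ < NS :=
  Literature.Geometry.DiscreteGeometry.KissingSearch.lt_NS_of_mem_symsList hr hσ

/-- K25 reading of the tree lemma `mkBr_ne_NOBR` (κ-free; proof = citation of the tree lemma). [folklore] -/
private theorem mkBr_ne_NOBR (lo hi : ℕ) : mkBr lo hi ≠ NOBR :=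
  Literature.Geometry.DiscreteGeometry.KissingSearch.mkBr_ne_NOBR lo hi

/-- K25 reading of the tree lemma `pi_lt_NLAD_mul` (κ-free; proof = citation of the tree lemma). [folklore] -/
private theorem pi_lt_NLAD_mul : π < (↑NLAD : ℝ) * (↑δ : ℝ) :=
  Literature.Geometry.DiscreteGeometry.KissingSearch.pi_lt_NLAD_mul


/-! ### Part A. Bracket codes and the enclosure relation -/

/-! ### Part B. The ladders -/

/-! ### Part C. Soundness of the basic bracket -/

/-- The point lies in the box of the symbols. [folklore] -/
theorem pt3_mem_symBox {a b c : ℕ} {x y z : ℝ} (hx : SymMem κ a x) (hy : SymMem κ b y)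
    (hz : SymMem κ c z) : ∀ i, pt3 x y z i ∈ (symBox κ a b c i).ratCast ℝ := by
  intro i
  unfold pt3 symBox
  by_cases h0 : i = 0
  · simp only [h0, ↓reduceIte]; exact hx
  · by_cases h1 : i = 1
    · simp only [h1, ↓reduceIte]; exact hy
    · simp only [h0, h1, ↓reduceIte]; exact hz

/-- **Soundness of the basic bracket.**  If `x, y, z` lie in the cells of `a, b, c`, `x², y² < 1`,
the circumradius polynomial is positive, and `θ ∈ [0, π]` satisfies the spherical law of
cosines `cos θ · (√(1-x²) √(1-y²)) = z - x y`, then `basic a b c` encloses `θ`.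
[cite: Moore1966, Theorem 3.1] -/
theorem basic_sound {a b c : ℕ} {x y z θ : ℝ} (hx : SymMem κ a x) (hy : SymMem κ b y) (hz : SymMem κ c z)
    (hx1 : x ^ 2 < 1) (hy1 : y ^ 2 < 1) (hP : 0 < Pfun x y z) (hθ0 : 0 ≤ θ) (hθπ : θ ≤ π)
    (hcos : Real.cos θ * (Real.sqrt (1 - x ^ 2) * Real.sqrt (1 - y ^ 2)) = z - x * y) :
    Encl (basic κ a b c) θ := by
  have hmem := pt3_mem_symBox hx hy hz
  have hθN : θ ≤ ((NLAD : ℕ) : ℝ) * (δ : ℝ) := hθπ.trans pi_lt_NLAD_mul.le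
  have wide : Encl (mkBr 0 NLAD) θ := by
    refine ⟨mkBr_ne_NOBR _ _, ?_, ?_⟩
    · rw [brLo_mkBr _ _ (by unfold NLAD; norm_num)]; simpa using hθ0
    · rw [brHi_mkBr _ _ (by unfold NLAD; norm_num)]; exact hθN
  unfold basic
  -- the circumradius enclosure
  cases hPe : pExpr.enclose PREC ITERS (symBox κ a b c) with
  | none => simpa using wide
  | some P =>
    dsimp only
    have hPmem := RExpr.eval_mem_enclose hmem pExpr hPe
    rw [eval_pExpr] at hPmem
    have hPsnd : Pfun x y z ≤ (P.snd : ℝ) := (mem_ratCast_iff.1 hPmem).2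
    have hnot : ¬ P.snd ≤ 0 := by
      intro h
      have : ((P.snd : ℚ) : ℝ) ≤ 0 := by exact_mod_cast h
      linarith
    rw [if_neg hnot]
    cases hQe : qExpr.enclose PREC ITERS (symBox κ a b c) with
    | none => simpa using wide
    | some Q =>
      dsimp only
      have hQmem := RExpr.eval_mem_enclose hmem qExpr hQe
      rw [eval_qExpr] at hQmem
      -- cos θ is the quotient
      have hsx : 0 < Real.sqrt (1 - x ^ 2) := Real.sqrt_pos.2 (by linarith)
      have hsy : 0 < Real.sqrt (1 - y ^ 2) := Real.sqrt_pos.2 (by linarith)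
      have hD : 0 < Real.sqrt (1 - x ^ 2) * Real.sqrt (1 - y ^ 2) := mul_pos hsx hsy
      have hq : (z - x * y) * (Real.sqrt (1 - x ^ 2) * Real.sqrt (1 - y ^ 2))⁻¹ = Real.cos θ := by
        rw [← hcos, mul_inv_cancel_right₀ hD.ne']
      rw [hq] at hQmem
      obtain ⟨hQ1, hQ2⟩ := mem_ratCast_iff.1 hQmem
      have hθeq : arccos (Real.cos θ) = θ := arccos_cos hθ0 hθπ
      refine ⟨mkBr_ne_NOBR _ _, ?_, ?_⟩
      · rw [brLo_mkBr _ _ (lt_of_le_of_lt (ladUp_le _) (by unfold NLAD; norm_num))]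
        refine (ladDown_mul_le_arccos _).trans ?_
        rw [← hθeq]
        apply arccos_le_arccos
        refine hQ2.trans ?_
        exact_mod_cast le_dyCeil PREC Q.snd
      · rw [brHi_mkBr _ _ (lt_of_le_of_lt (ladUp_le _) (by unfold NLAD; norm_num))]
        refine le_trans ?_ (arccos_le_ladUp_mul _)
        rw [← hθeq]
        apply arccos_le_arccos
        refine le_trans ?_ hQ1
        exact_mod_cast dyFloor_le PREC Q.fst

/-- The endpoints of the cell of a symbol bound its elements: `|x| ≤ 1/2` for the contact symbol
and for the cells `1 … K`. [folklore] -/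
theorem abs_le_half_of_symMem {σ : ℕ} {x : ℝ} (hσ : σ ≤ K) (h : SymMem κ σ x) :
    -(1 / 2 : ℝ) ≤ x ∧ x ≤ 1 / 2 := by
  unfold SymMem symIv at h
  by_cases h0 : σ = 0
  · simp only [h0, ↓reduceIte] at h
    rw [mem_ratCast_iff] at h
    unfold mkIv at h
    simp only [min_self, max_self] at h
    push_cast at h
    exact ⟨by linarith [h.1], by linarith [h.2]⟩
  · simp only [h0, ↓reduceIte] at h
    rw [mem_ratCast_iff] at h
    unfold mkIv at h
    simp only at h
    have hlo : (-(1 / 2) : ℚ) ≤ min (gridPt κ (σ - 1)) (gridPt κ σ) := by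
      have : ∀ j : ℕ, (-(1/2) : ℚ) ≤ gridPt κ j := fun j => by
        have hnn : (0 : ℚ) ≤ (κ.val + 1 / 2) * j / K := by
          have h0 : (0 : ℚ) ≤ κ.val + 1 / 2 := by linarith [κ.neg_half_le]
          exact div_nonneg (mul_nonneg h0 (by positivity)) (by positivity)
        unfold gridPt; linarith
      exact le_min (this _) (this _)
    have hhi : max (gridPt κ (σ - 1)) (gridPt κ σ) ≤ (1 / 2 : ℚ) := by
      have : ∀ j : ℕ, j ≤ K → gridPt κ j ≤ (1/2 : ℚ) := fun j hj => by
        unfold gridPt K at *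
        have : (j : ℚ) ≤ 15 := by exact_mod_cast hj
        have h1 := κ.neg_half_le; have h2 := κ.lt_quarter
        nlinarith
      exact max_le (this _ (by omega)) (this _ hσ)
    have hlo' : ((-(1 / 2) : ℚ) : ℝ) ≤ x := le_trans (by exact_mod_cast hlo) h.1
    have hhi' : x ≤ ((1 / 2 : ℚ) : ℝ) := le_trans h.2 (by exact_mod_cast hhi)
    push_cast at hlo' hhi'
    exact ⟨hlo', hhi'⟩

/-- Hence `x² < 1` on every cell. [folklore] -/
theorem sq_lt_one_of_symMem {σ : ℕ} {x : ℝ} (hσ : σ ≤ K) (h : SymMem κ σ x) : x ^ 2 < 1 := by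
  obtain ⟨h1, h2⟩ := abs_le_half_of_symMem hσ h
  nlinarith

/-! ### Part D. Tables and folds -/

/-- **The table lookup `btab` is `basic`** (in range). [folklore] -/
theorem btab_eq {a b c : ℕ} (ha : a < NS) (hb : b < NS) (hc : c < NS) : btab κ a b c = basic κ a b c := by
  unfold btab BTAB
  rw [NS_eq] at ha hb hc ⊢
  have hidx : (a * 16 + b) * 16 + c < 16 * 16 * 16 := by omega
  rw [Array.getD_eq_getD_getElem?, Array.getElem?_ofFn]
  simp only [hidx, ↓reduceDIte, Option.getD_some]
  congr 1 <;> omega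

/-- **Soundness of `rangeC`**: it encloses whatever one of its cells' basic brackets encloses.
[folklore] -/
theorem rangeC_sound {a b r σ : ℕ} {θ : ℝ} (hσ : σ ∈ symsList r) (h : Encl (btab κ a b σ) θ) :
    Encl (rangeC κ a b r) θ := by
  unfold rangeC
  rw [foldSyms_eq_foldl]
  exact encl_foldl_of_mem (g := fun c => btab κ a b c) NOBR hσ h

/-- **The table lookup `t1` is `rangeC`** (in range, valid domain). [folklore] -/
theorem t1_eq {a b r : ℕ} (ha : a < NS) (hb : b < NS) (hr : ValidDom r) : t1 κ a b r = rangeC κ a b r := by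
  unfold t1 T1TAB
  rw [NS_eq] at ha hb ⊢
  rcases hr with rfl | ⟨h1, h2, h3, h4⟩
  · simp only [↓reduceIte, Nat.add_zero]
    have hidx : (a * 16 + b) * 256 < 16 * 16 * 256 := by omega
    rw [Array.getD_eq_getD_getElem?, Array.getElem?_ofFn]
    simp only [hidx, ↓reduceDIte, Option.getD_some]
    have e1 : (a * 16 + b) * 256 % 256 = 0 := by omega
    have e2 : (a * 16 + b) * 256 / 256 = a * 16 + b := by omega
    simp only [e1, ↓reduceIte, e2]
    congr 1 <;> omega
  · have hne : r ≠ 0 := by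
      intro h0; rw [h0] at h1; unfold rLo at h1; simp at h1
    simp only [hne, ↓reduceIte]
    have hK : K = 15 := rfl
    have hlo : rLo r ≤ 15 := by omega
    have hhi : rHi r < 16 := by unfold rHi; omega
    have hidx : (a * 16 + b) * 256 + (16 * rLo r + rHi r) < 16 * 16 * 256 := by omega
    rw [Array.getD_eq_getD_getElem?, Array.getElem?_ofFn]
    simp only [hidx, ↓reduceDIte, Option.getD_some]
    have e1 : ((a * 16 + b) * 256 + (16 * rLo r + rHi r)) % 256 = 16 * rLo r + rHi r := by omega
    have e2 : ((a * 16 + b) * 256 + (16 * rLo r + rHi r)) / 256 = a * 16 + b := by omega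
    have e3 : 16 * rLo r + rHi r ≠ 0 := by omega
    simp only [e1, e3, ↓reduceIte, e2]
    have e4 : (16 * rLo r + rHi r) / 16 = rLo r := by omega
    have e5 : (16 * rLo r + rHi r) % 16 = rHi r := by omega
    rw [e4, e5, ← h4]
    congr 1 <;> omega

/-- **Soundness of `rangeBr`**: for symbols `σa ∈ ra`, `σb ∈ rb` (valid domains) and a valid
`rc`, it encloses whatever `rangeC σa σb rc` encloses. [folklore] -/
theorem rangeBr_sound {ra rb rc σa σb : ℕ} {θ : ℝ} (hra : ValidDom ra) (hrb : ValidDom rb)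
    (hrc : ValidDom rc) (hσa : σa ∈ symsList ra) (hσb : σb ∈ symsList rb)
    (h : Encl (rangeC κ σa σb rc) θ) : Encl (rangeBr κ ra rb rc) θ := by
  have ha := lt_NS_of_mem_symsList hra hσa
  have hb := lt_NS_of_mem_symsList hrb hσb
  have key : Encl (t1 κ σa σb rc) θ := by rw [t1_eq ha hb hrc]; exact h
  have inner : ∀ (acc : ℕ), Encl (foldSyms (fun acc' b => brHull acc' (t1 κ σa b rc)) rb acc) θ := by
    intro acc
    rw [foldSyms_eq_foldl]
    exact encl_foldl_of_mem (g := fun b => t1 κ σa b rc) acc hσb key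
  have mono : ∀ (acc a : ℕ), Encl acc θ →
      Encl (foldSyms (fun acc' b => brHull acc' (t1 κ a b rc)) rb acc) θ := by
    intro acc a hacc
    rw [foldSyms_eq_foldl]
    exact encl_foldl_of_acc (g := fun b => t1 κ a b rc) hacc
  unfold rangeBr
  by_cases hra0 : ra = 0
  · have hσa0 : σa = 0 := by unfold symsList at hσa; simpa [hra0] using hσa
    subst hσa0
    by_cases hrb0 : rb = 0
    · have hσb0 : σb = 0 := by unfold symsList at hσb; simpa [hrb0] using hσb
      subst hσb0
      simp only [hra0, hrb0, ↓reduceIte]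
      exact key
    · simp only [hra0, hrb0, ↓reduceIte]
      rw [foldSyms_eq_foldl]
      exact encl_foldl_of_mem (g := fun b => t1 κ 0 b rc) NOBR hσb key
  · by_cases hrb0 : rb = 0
    · have hσb0 : σb = 0 := by unfold symsList at hσb; simpa [hrb0] using hσb
      subst hσb0
      simp only [hra0, hrb0, ↓reduceIte]
      rw [foldSyms_eq_foldl]
      exact encl_foldl_of_mem (g := fun a => t1 κ a 0 rc) NOBR hσa key
    · simp only [hra0, hrb0, ↓reduceIte]
      rw [foldSyms_eq_foldl]
      exact encl_foldl_of_step (F := fun acc a => foldSyms (fun acc' b => brHull acc' (t1 κ a b rc)) rb acc)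
        mono inner _ NOBR hσa

/-- **`THMIN` is below every feasible basic bracket** (with symbols `< NS`). [folklore] -/
theorem THMIN_le {a b c : ℕ} (ha : a < NS) (hb : b < NS) (hc : c < NS) (h : basic κ a b c ≠ NOBR) :
    THMIN κ ≤ brLo (basic κ a b c) := by
  unfold THMIN
  rw [← Array.foldl_toList]
  refine foldl_minBr_le_of_mem ?_ h NLAD
  unfold BTAB
  rw [Array.toList_ofFn, List.mem_ofFn]
  rw [NS_eq] at ha hb hc
  refine ⟨⟨(a * 16 + b) * 16 + c, by rw [NS_eq]; omega⟩, ?_⟩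
  simp only [NS_eq]
  congr 1 <;> omega


end GSearch

end Summit.Ventures.Crystal3D.Kissing125
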